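import Literature.NumberTheory.Automorphic.ArchEndoscopicChartOrbUnfoldLeavesGiven   -- ★ p851388 (this seat): `exists_smul_map_descConj_quotientMeasure_of_eq`; brings ★ (A0) `abs_sub_smul_integral_descConj_hypBlockGL_eq_smul_integral_prod`, ★ Iwasawa `exists_measure_quotient_torusU_complex_two_eq_smul_map`, ★ `quotientMeasure`
import HarnessLib

/-!
# (JH-A′) THE SPLIT LEAF IN HALF-CHART CURRENCY: from the quotient identity of a split leaf `Λ` (★ `exists_placeLeaf` ∕ (JH-A)'s clause at the split place) to the
# `K × N` cone integral — `∫ G(z₁ γ z₂ z₁⁻¹) dΛ(z) = ((C ∕ C′) · e^{−x}) • ∫_{K × N} G(k · (t_{0,θ} h_{x∕2} n h_{x∕2}) · k⁻¹) d(κ ⊗ μ_N)`, `C` BEFORE `G`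
# (L3′ forward half (J)-H of the LH3 direct road, JH-SPEC v2 §3; Varadarajan 1989 §6.4, Gelbart 1975 Thm. 9.22, Deitmar–Echterhoff Thm. 1.5.3)

Topic `NumberTheory/Automorphic`; namespace `Literature.NumberTheory.Automorphic.UnitaryGroup`.  THEOREMS ONLY (no `def`, no instance, no axiom, no `sorry`).  Cell
`pub/hodgecm-mathlib`, crux H413 (`stmt-HodgeConjecture-24833`), line LH3 (closer stub `stub_N9`, DIRECT ROAD), organ L3′ forward half (J)-H, brick **(JH-A′)** «split leaf in
half-chart currency» of JH-SPEC v2 (LH3-p01 (g5), binder of record; consumers (JH-B) LH10-p01 (g5), (JH-desc) LH3-p01).  Author LH10-p02 (g7).  Count-neutral.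

WHAT.  In the `U(conj, J)(ℂ)` currency (`J` the anti-diagonal form; a consumer at a complex place `w₀` passes `U(Φ₂)_{w₀} =` ★ `archLocal L 2 Φ₂ w₀`, its instances, `T′ :=` ★
`chartTorusHLoc L (insert w₀ S) w₀` with ★ `chartTorusHLoc_eq_torusU`, `t :=` ★ `chartHaarHLoc`, `γ := endoBlockAt L (insert w₀ S) w₀` with ★ `endoBlockAt_eq_mk_hypBlockGL`, and
(JH-A)'s quotient-identity clause for `Λ := Λw′ w₀`, exactly as ★ `exists_placeLeaf` consumes ★ `exists_leaf_of_eq_torusU`):  fix an Iwasawa datum — a compact `K ≤ U(J)` with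
`U(J) = K·B`, Haar measures `κ` on `K` and `μ_N` on `N` — BEFORE everything; let a measure `Λ` on `U(J) × U(J)` and `C′ ≠ 0` satisfy the QUOTIENT IDENTITY
`(descConj γ(cw) T′)_* (ν ∕ t) = (C′ · ‖e^{−2x} − 1‖⁻¹) • (z ↦ z₁ γ(cw) z₂ z₁⁻¹)_* Λ` (`x = cw 0 ≠ 0`, `γ(cw) = diag(e^{x+iθ}, e^{−x+iθ})`, `θ = cw 2`).  Then there is ONE `C ≠ 0` (before
the test function) with, for every continuous Banach-valued `G` and every `cw` with `x ≠ 0`,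
**`∫ G(z₁ γ(cw) z₂ z₁⁻¹) dΛ(z) = ((C ∕ C′) · e^{−x}) • ∫_{K × N} G(k · (t_{0,θ} · h_{x∕2} · n · h_{x∕2}) · k⁻¹) d(κ ⊗ μ_N)`** (`t_{0,θ} = diag(e^{iθ}, e^{iθ})`, `h_{x∕2} = diag(e^{x∕2}, e^{−x∕2})`
— ★ 4d's `hΛ` token).  Route: integrate `G` against the quotient identity (`integral_map`); transport the quotient orbital measure from `(T′, t)` to `(torusU, t)` (★
`exists_smul_map_descConj_quotientMeasure_of_eq` — here `T′ = torusU` by `subst`, scalar `1` would do, but the transport is kept so that NO Borel structure is rewritten);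
the canonical quotient measure `ν ∕ t` is invariant, Radon and non-zero (★ `smulInvariantMeasure_quotientMeasure`, ★ `quotientMeasure_ne_zero`), hence of Iwasawa form
`C₁ • ((k,n) ↦ knT)_*(κ ⊗ μ_N)` (★ `exists_measure_quotient_torusU_complex_two_eq_smul_map`); ★ (A0) `abs_sub_smul_integral_descConj_hypBlockGL_eq_smul_integral_prod` reads the
orbital integral in the `K × N` chart with the module `|eˣ − e⁻ˣ|`; and `‖e^{−2x} − 1‖ ∕ |eˣ − e⁻ˣ| = e^{−x}` (★ `abs_exp_sub_exp_neg_mul_norm_inv`).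
HONEST LABEL: HC_CM is proved only modulo the 7 printed citations (2 remaining: hLiu418 = stmt-HodgeConjecture-24832, h413 = stmt-HodgeConjecture-24833) until rung 0 closes;
measure-theoretic bookkeeping, pays nothing by itself.

## References
* [Varadarajan1989] V. S. Varadarajan, *An Introduction to Harmonic Analysis on Semisimple Lie Groups* (1989), §6.4 Lemma 21, Thm 23.
* [Gelbart1975] S. Gelbart, *Automorphic Forms on Adele Groups*, Ann. of Math. Stud. 83 (1975), Thm. 9.22 (iii), (9.13).
* [DeitmarEchterhoff2014] A. Deitmar, S. Echterhoff, *Principles of Harmonic Analysis*, 2nd ed. (2014), Thm. 1.5.3, Cor. 1.5.4.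
* [Rogawski1990] J. D. Rogawski, *Automorphic Representations of Unitary Groups in Three Variables*, Ann. of Math. Stud. 123 (1990), §4.9 p. 55; §8.2 pp. 119–122.
-/

set_option autoImplicit false

noncomputable section

open MeasureTheory MeasureTheory.Measure Matrix Complex Topology Set
open Literature.MeasureTheory.Group
open scoped MatrixGroups Matrix ENNReal NNReal ComplexConjugate

namespace Literature.NumberTheory.Automorphic.UnitaryGroup

open Literature.NumberTheory.Rogawski1990
open Literature.NumberTheory.Automorphic.UnitaryGroup.HeisRing Literature.NumberTheory.Automorphic.UnitaryGroup.LineRing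

/-- `descConj` does not see the proof that the subgroup centralises the point: equal points give equal orbital integrands (local copy of ★ UnfoldSplit's private helper).
[folklore] -/
private theorem descConj_congr_point' {G : Type*} [Group G] {γ γ' : G} (M : Subgroup G) (h : ∀ m ∈ M, m * γ = γ * m) (h' : ∀ m ∈ M, m * γ' = γ' * m)
    (hγ : γ = γ') {α : Type*} (F : G → α) : descConj γ M h F = descConj γ' M h' F := by
  subst hγ; rfl

/-- **(JH-A′) THE SPLIT LEAF IN HALF-CHART CURRENCY.**  `U(J) = U(conj, J)(ℂ)` with `J` anti-diagonal; `T′ = torusU` (as a variable, by `subst`), `t` an inversion-invariant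
Haar measure on `T′`, `ν` a Haar measure on `U(J)`; an Iwasawa datum `(K, hKB, κ, μ_N)` fixed FIRST; a chart `γ(cw) = hypBlockGL (cw 0) (cw 2)`; a measure `Λ` on `U(J) × U(J)`
and `C′ ≠ 0` with the QUOTIENT IDENTITY `(descConj γ(cw) T′)_* (ν ∕ t) = (C′ · ‖e^{−2 cw 0} − 1‖⁻¹) • (z ↦ z₁ γ(cw) z₂ z₁⁻¹)_* Λ` for `cw 0 ≠ 0`.  Then ONE `C ≠ 0` — chosen before the
test function — satisfies, for every continuous Banach-valued `G` and every `cw` with `cw 0 ≠ 0`: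
`∫ G(z₁ γ(cw) z₂ z₁⁻¹) dΛ(z) = ((C ∕ C′) · e^{−cw 0}) • ∫_{K × N} G(k · (t_{0, cw 2} · h_{cw 0 ∕ 2} · n · h_{cw 0 ∕ 2}) · k⁻¹) d(κ ⊗ μ_N)`.  All instance binders are NAMED (consumers
whose group is a definitional copy of `U(J)` pass their own). [cite: Varadarajan1989, §6.4 Lemma 21, Thm 23] [cite: Gelbart1975, Thm. 9.22 (iii)] [cite: DeitmarEchterhoff2014, Thm. 1.5.3]
[cite: Rogawski1990, §8.2 pp. 119–122] -/
theorem exists_integral_leaf_eq_smul_integral_halfChart {J : Matrix (Fin 2) (Fin 2) ℂ} (hJ : J = (StdForm.antidiagonal 2).over ℂ)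
    [iM : MeasurableSpace ↥(unitaryGroupOfForm (starRingEnd ℂ) J)] [iB : BorelSpace ↥(unitaryGroupOfForm (starRingEnd ℂ) J)]
    [iLC : LocallyCompactSpace ↥(unitaryGroupOfForm (starRingEnd ℂ) J)] [iSC : SecondCountableTopology ↥(unitaryGroupOfForm (starRingEnd ℂ) J)]
    {T' : Subgroup ↥(unitaryGroupOfForm (starRingEnd ℂ) J)} (hT' : T' = torusU (starRingEnd ℂ) J)
    (hT'c : IsClosed (T' : Set ↥(unitaryGroupOfForm (starRingEnd ℂ) J)))
    [iMq : MeasurableSpace (↥(unitaryGroupOfForm (starRingEnd ℂ) J) ⧸ T')] [iBq : BorelSpace (↥(unitaryGroupOfForm (starRingEnd ℂ) J) ⧸ T')]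
    (t : Measure ↥T') [it : t.IsHaarMeasure] [iti : t.IsInvInvariant]
    (ν : Measure ↥(unitaryGroupOfForm (starRingEnd ℂ) J)) [iν : ν.IsHaarMeasure] [iνr : ν.IsMulRightInvariant]
    {K : Subgroup ↥(unitaryGroupOfForm (starRingEnd ℂ) J)} (hK : IsCompact (K : Set ↥(unitaryGroupOfForm (starRingEnd ℂ) J)))
    (hKB : ∀ g : ↥(unitaryGroupOfForm (starRingEnd ℂ) J), ∃ k ∈ K, ∃ b ∈ borelU (starRingEnd ℂ) J, g = k * b)
    (κ : Measure ↥K) [iκ : IsHaarMeasure κ] (μN : Measure ↥(unipotentU (starRingEnd ℂ) J)) [iμN : IsHaarMeasure μN]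
    (γ : (Fin 3 → ℝ) → ↥(unitaryGroupOfForm (starRingEnd ℂ) J))
    (hγ : ∀ cw, γ cw = ⟨hypBlockGL (cw 0) (cw 2), hypBlockGL_mem_of_eq_over hJ (cw 0) (cw 2)⟩) (hcomm : ∀ cw, ∀ m ∈ T', m * γ cw = γ cw * m)
    (Λ : Measure (↥(unitaryGroupOfForm (starRingEnd ℂ) J) × ↥(unitaryGroupOfForm (starRingEnd ℂ) J))) (C' : ℝ≥0) (hC' : C' ≠ 0)
    (hquot : ∀ cw : Fin 3 → ℝ, cw 0 ≠ 0 →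
      Measure.map (descConj (γ cw) T' (hcomm cw) id) (quotientMeasure T' t hT'c ν) =
        (C' * ‖(((Real.exp (-2 * cw 0) : ℝ) : ℂ)) - 1‖₊⁻¹) •
          Measure.map (fun z : ↥(unitaryGroupOfForm (starRingEnd ℂ) J) × ↥(unitaryGroupOfForm (starRingEnd ℂ) J) => z.1 * (γ cw * z.2) * z.1⁻¹) Λ) :
    ∃ C : ℝ≥0, C ≠ 0 ∧ ∀ {E : Type*} [NormedAddCommGroup E] [NormedSpace ℝ E] (G : ↥(unitaryGroupOfForm (starRingEnd ℂ) J) → E), Continuous G →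
      ∀ cw : Fin 3 → ℝ, cw 0 ≠ 0 →
        ∫ z, G (z.1 * (γ cw * z.2) * z.1⁻¹) ∂Λ =
          (((C : ℝ) / C') * Real.exp (-(cw 0))) • ∫ p : ↥K × ↥(unipotentU (starRingEnd ℂ) J),
            G ((p.1 : ↥(unitaryGroupOfForm (starRingEnd ℂ) J)) *
              ((⟨hypBlockGL 0 (cw 2), hypBlockGL_mem_of_eq_over hJ 0 (cw 2)⟩ : ↥(unitaryGroupOfForm (starRingEnd ℂ) J)) *
                (⟨hypBlockGL (cw 0 / 2) 0, hypBlockGL_mem_of_eq_over hJ (cw 0 / 2) 0⟩ : ↥(unitaryGroupOfForm (starRingEnd ℂ) J)) *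
                (p.2 : ↥(unitaryGroupOfForm (starRingEnd ℂ) J)) *
                (⟨hypBlockGL (cw 0 / 2) 0, hypBlockGL_mem_of_eq_over hJ (cw 0 / 2) 0⟩ : ↥(unitaryGroupOfForm (starRingEnd ℂ) J))) *
              (p.1 : ↥(unitaryGroupOfForm (starRingEnd ℂ) J))⁻¹) ∂(κ.prod μN) := by
  subst hT'
  haveI : LocallyCompactSpace ↥(torusU (starRingEnd ℂ) J) := hT'c.isClosedEmbedding_subtypeVal.locallyCompactSpace
  haveI : CompactSpace ↥K := isCompact_iff_compactSpace.1 hK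
  -- (1) the canonical quotient measure `ν ∕ t` is invariant, Radon and non-zero, hence of Iwasawa form w.r.t. `(κ, μ_N)`
  haveI : SMulInvariantMeasure ↥(unitaryGroupOfForm (starRingEnd ℂ) J) (↥(unitaryGroupOfForm (starRingEnd ℂ) J) ⧸ torusU (starRingEnd ℂ) J)
      (quotientMeasure (torusU (starRingEnd ℂ) J) t hT'c ν) := smulInvariantMeasure_quotientMeasure _ t hT'c ν
  have hμ : quotientMeasure (torusU (starRingEnd ℂ) J) t hT'c ν ≠ 0 := quotientMeasure_ne_zero _ t hT'c ν
  obtain ⟨C, hC, hμC⟩ := exists_measure_quotient_torusU_complex_two_eq_smul_map hJ hK hKB κ t μN (quotientMeasure (torusU (starRingEnd ℂ) J) t hT'c ν) hμ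
  refine ⟨C, hC, fun {E} _ _ G hG cw hcw => ?_⟩
  -- abbreviations: `x`, `θ`, the scalar `X = ‖e^{−2x} − 1‖⁻¹`, the module `D = |eˣ − e⁻ˣ|`
  have hne1 : (((Real.exp (-2 * cw 0) : ℝ) : ℂ)) - 1 ≠ 0 := by
    rw [ne_eq, sub_eq_zero, ← Complex.ofReal_one, Complex.ofReal_inj, Real.exp_eq_one_iff]
    intro h
    exact hcw (by linarith)
  have hX : (‖(((Real.exp (-2 * cw 0) : ℝ) : ℂ)) - 1‖₊ : ℝ≥0) ≠ 0 := nnnorm_ne_zero_iff.2 hne1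
  have hXr : (‖(((Real.exp (-2 * cw 0) : ℝ) : ℂ)) - 1‖ : ℝ) ≠ 0 := norm_ne_zero_iff.2 hne1
  have hXr2 : (‖(((Real.exp (-(2 * cw 0)) : ℝ) : ℂ)) - 1‖ : ℝ) ≠ 0 := by simpa only [neg_mul] using hXr
  have hD : |Real.exp (cw 0) - Real.exp (-(cw 0))| ≠ 0 := by
    rw [ne_eq, abs_eq_zero, sub_eq_zero]
    intro h
    have h' : cw 0 = -(cw 0) := Real.exp_injective h
    exact hcw (by linarith)
  -- (2) integrate `G` against the quotient identity: `∫ G ∘ descConj d(ν∕t) = (C′ X) • ∫ G(z₁ γ z₂ z₁⁻¹) dΛ`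
  have hm : Continuous (fun z : ↥(unitaryGroupOfForm (starRingEnd ℂ) J) × ↥(unitaryGroupOfForm (starRingEnd ℂ) J) => z.1 * (γ cw * z.2) * z.1⁻¹) :=
    (continuous_fst.mul (continuous_const.mul continuous_snd)).mul continuous_fst.inv
  have hd : Continuous (descConj (γ cw) (torusU (starRingEnd ℂ) J) (hcomm cw) id) := continuous_descConj _ _ _ continuous_id
  have h2 : ∫ y, descConj (γ cw) (torusU (starRingEnd ℂ) J) (hcomm cw) G y ∂(quotientMeasure (torusU (starRingEnd ℂ) J) t hT'c ν) =
      ((C' * ‖(((Real.exp (-2 * cw 0) : ℝ) : ℂ)) - 1‖₊⁻¹ : ℝ≥0) : ℝ) • ∫ z, G (z.1 * (γ cw * z.2) * z.1⁻¹) ∂Λ := by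
    have h : ∫ x, G x ∂(Measure.map (descConj (γ cw) (torusU (starRingEnd ℂ) J) (hcomm cw) id) (quotientMeasure (torusU (starRingEnd ℂ) J) t hT'c ν)) =
        ∫ x, G x ∂((C' * ‖(((Real.exp (-2 * cw 0) : ℝ) : ℂ)) - 1‖₊⁻¹) •
          Measure.map (fun z : ↥(unitaryGroupOfForm (starRingEnd ℂ) J) × ↥(unitaryGroupOfForm (starRingEnd ℂ) J) => z.1 * (γ cw * z.2) * z.1⁻¹) Λ) := by
      rw [hquot cw hcw]
    rw [integral_map hd.aemeasurable hG.aestronglyMeasurable, integral_smul_nnreal_measure, integral_map hm.aemeasurable hG.aestronglyMeasurable,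
      NNReal.smul_def] at h
    rw [descConj_eq_comp (γ cw) (torusU (starRingEnd ℂ) J) (hcomm cw) G]
    exact h
  -- (3) ★ (A0): the orbital integral over the class of `γ(cw) = hypBlockGL x θ` in the `K × N` chart
  have h3 := abs_sub_smul_integral_descConj_hypBlockGL_eq_smul_integral_prod hJ κ μN (quotientMeasure (torusU (starRingEnd ℂ) J) t hT'c ν) hμC G hG (cw 2) hcw
  rw [← descConj_congr_point' (torusU (starRingEnd ℂ) J) (hcomm cw)
    (LineRing.forall_mem_torusU_comm (starRingEnd ℂ) J (hypBlockGL_mem_torusU hJ (cw 0) (cw 2))) (hγ cw) G, h2, smul_smul] at h3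
  -- (4) the scalars: `D · (C′ X) • A = C • R` ⇒ `A = ((C ∕ C′) · e^{−x}) • R`, since `X⁻¹ ∕ D = e^{−x}`
  have hscal : |Real.exp (cw 0) - Real.exp (-(cw 0))| * (((C' * ‖(((Real.exp (-2 * cw 0) : ℝ) : ℂ)) - 1‖₊⁻¹ : ℝ≥0) : ℝ)) ≠ 0 :=
    mul_ne_zero hD (by exact_mod_cast mul_ne_zero hC' (inv_ne_zero hX))
  have hA := congrArg (fun v : E => (|Real.exp (cw 0) - Real.exp (-(cw 0))| * (((C' * ‖(((Real.exp (-2 * cw 0) : ℝ) : ℂ)) - 1‖₊⁻¹ : ℝ≥0) : ℝ)))⁻¹ • v) h3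
  rw [smul_smul, inv_mul_cancel₀ hscal, one_smul, smul_smul] at hA
  rw [hA]
  congr 1
  have hkey := abs_exp_sub_exp_neg_mul_norm_inv (cw 0) hcw
  have hC'r : ((C' : ℝ≥0) : ℝ) ≠ 0 := by exact_mod_cast hC'
  have hE : Real.exp (cw 0) ≠ 0 := (Real.exp_pos _).ne'
  have hDX : |Real.exp (cw 0) - Real.exp (-(cw 0))| = Real.exp (cw 0) * ‖(((Real.exp (-2 * cw 0) : ℝ) : ℂ)) - 1‖ := (mul_inv_eq_iff_eq_mul₀ hXr).1 hkey
  rw [NNReal.coe_mul, NNReal.coe_inv, coe_nnnorm, hDX, Real.exp_neg]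
  field_simp

end Literature.NumberTheory.Automorphic.UnitaryGroup

end
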